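/-
Copyright: lit-balaban cell, Phase-2 proof seat p11 (gen 5).  Statement-level skeleton of a published paper; no proof claims beyond
what the kernel checks below.
-/
import Literature.MathematicalPhysics.QuantumFieldTheory.BalabanImbrieJaffe1984to88.BIJ85HolonomyDefect
import Literature.MathematicalPhysics.QuantumFieldTheory.Balaban1983to89.Beta.CoordCubePoincare

/-!
# `BalabanImbrieJaffe1984to88.BIJ85CovariantPoincare` — T. Bałaban, J. Imbrie, A. Jaffe, *Renormalization of the Higgs model:
minimizers, propagators and the stability of mean field theory*, Commun. Math. Phys. **97** (1985) 299–329
[BalabanImbrieJaffe1985]: Sect. 7.3 p. 326 at a GENERAL background — **the `u`-UNIFORM mass bound for the blocks** (HOME/GAPS.md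
G-C1-05 item (ii): *"a u-uniform covariant Poincaré inequality for −Δ_{u_k} + a_kQ_k^*Q_k is needed to land the error on Σ|φ(x)|²"*).
For EVERY `U(1)` field `u` on the `η`-lattice torus with plaquette variables within `θ` of `1`, every `k` with `j + k ≤ m + K` and every
`η`-lattice scalar field `φ`:
`N^{−1}Σ_x|φ(x)|² ≤ Σ_y|(Q_k(u)φ)(y)|² + 2(n²/N)Σ_b|u_bφ(b₊) − φ(b₋)|² + d³(n²θ)²·N^{−1}Σ_x|φ(x)|²`, `n = L^k`, `N = L^{kd}`
— with NO constant depending on `k`, `L` or the volume; for `n²θ ≤ (2d³)^{−1/2}` the last term is absorbed.  File 3 of the general-background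
member of SKELETON row **C1.Eq7.3.1-7.3.2** (seat p11 gen 5; files 1–2 `BIJ85AbelianStokes`, `BIJ85HolonomyDefect`).

RELATION TO p33 g6's `BIJ85BlockKPoincare` (landed meanwhile, same row): its `sum_norm_sq_le_cov` is the `k`-block covariant Poincaré
inequality under the BONDWISE hypothesis `|u_b − 1| ≤ T` on the intra-block bonds (a fixed gauge in which the field is near `1`) plus a
tree-holonomy deviation `δ`; here NOTHING bondwise is assumed — only the gauge-invariant smallness `‖u(∂p) − 1‖ ≤ θ` of the plaquette
variables — the field is made bondwise close to `1` INSIDE the proof by passing to the tree (axial) gauge of each block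
(`covPoincare_block`), and the levels are telescoped (`massBound`) instead of charting `B^k(y)` at once.

statement-level skeleton of published theorems with citation tags; proofs where landed; nothing here is a claim about the Yang–Mills mass gap

PDF held: `paper:balaban1985-cmp97-bij-higgs-minimizers` (journal page = PDF page + 298).  Pages read this session: p. 325–326 [PDF 27–28].

CITATION HEADER (lean-in-tree rule).  Phase-2 file of the lit-balaban TYPED SKELETON (HOME `run/shared/lean/pub/lit-balaban/`), seat
p11 gen 5 (unit `lit-balaban-p11-g5`; TAKING line HOME/STATUS.md 2026-08-21T10:52:36Z; owner r15, referee ref-5).  WHAT IS REPRODUCED: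
the `u`-uniform Poincaré input of the unprinted *"extension of the proofs of [7]"* for SKELETON row **C1.Eq7.3.1-7.3.2** (`typed p239582`)
— [7] = [Balaban1983RegularityDecay] (B4), whose Prop. 3.1′ proof §4 uses the same elementary averaging/Poincaré route at a small field;
here on the C1 torus carriers of record at an ARBITRARY `U(1)` background, the field strength entering only through `θ`.  Carriers of
record only, BY NAME: `Setup` tori/bonds/blocks, r18's `BIJ85BlockAveragesTorus` (`holC` = `u(Γ_{yx})`, `qCov` = (2.6), `blockSite` charts
as in gen 4's `BIJ85FluctuationCovarianceFlatBounds` §1), gen 3's `qCovK`/`lineIter`/`blockK`, gen 4's `sum_norm_qCovK_shift_sub_sq_le_cov`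
(the covariant block-averaging inequality with holonomy defect) and `sum_blockK_sum`, files 1–2 (`plaqC`, `norm_treeLoop_sub_one_le`,
`norm_blockContourDefect_sub_one_le'`, `norm_plaqC_lineIter_sub_one_le`), the β-cell's kernel `Beta.CoordCubePoincare.blockPoincare_of_charts`.

THE PRINTED TEXT, verbatim (p. 326 [PDF 28]): *"⟨φ, Δ_k(u_k)φ⟩ ≥ γ Σ_{b∈T₁^{(k)}} |u_k(b)φ(b₊) − φ(b₋)|² − Me_k^{2−α} Σ_{x∈T₁^{(k)}} |φ(x)|².
(7.3.2) … These inequalities can be proved by an extension of the proofs of [7]."*; p. 303 [PDF 5]: *"(Qφ)_y = L^{−d} Σ_{x∈B(y)} u(Γ_{yx})φ_x.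
(2.6)"*.

WHAT IS PROVED (0 `sorry`, standard axioms; theorems only, no `def`).
* §1–§2 the one-level block Poincaré inequality on the torus for COMPLEX functions with the covariant mean: for `g = u(Γ_{y·})φ` on `B(y)`,
  `Σ_{x∈B(y)}|φ(x)|² = L^d|(Q(u)φ)(y)|² + Σ_{x∈B(y)}|g(x) − (Q(u)φ)(y)|²` (Steiner, `|u(Γ_{yx})| = 1`) and
  `Σ_{x∈B(y)}|g(x) − (Q(u)φ)(y)|² ≤ (L(L−1)/2)·Σ_{b⊂B(y)}|g(b₊) − g(b₋)|²` (the β-cell's cube Poincaré through the `blockSite` chart, re/im).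
* §3 **the tree-gauge gradient**: `g(b₊) − g(b₋) = u(Γ_{yb₊})(1 − ρ_b)φ(b₊) + u(Γ_{yb₋})(u_bφ(b₊) − φ(b₋))`, `ρ_b` the tree loop of file 2,
  so `|g(b₊) − g(b₋)|² ≤ 2|u_bφ(b₊) − φ(b₋)|² + 2(d(L−1)θ)²|φ(b₊)|²` for in-block bonds (`norm_treeGrad_sq_le`).
* §4 **the one-level COVARIANT Poincaré inequality with defect**, every `u`: `Σ_x|φ(x)|² ≤ L^dΣ_y|(Q(u)φ)(y)|² + L(L−1)[Σ_b|u_bφ(b₊) − φ(b₋)|² +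
  d(d(L−1)θ)²Σ_x|φ(x)|²]` (`covPoincare_oneLevel`).
* §5 **THE MULTISCALE MASS BOUND** (`massBound`): the display above, by telescoping §4 over the levels `i < k` (level `i`: field `u^{(i)} =
  lineIter u i` with plaquettes `≤ L^{2i}θ`, file 1; the level-`i` bond form of `Q_i(u)φ` by gen 4's covariant block-averaging inequality whose
  defect is `≤ dL^i(L^i−1)θ`, file 2; Jensen `Σ_y|(Q_i(u)φ)(y)|² ≤ L^{−id}Σ|φ|²`), the geometric sums being absorbed step by step into the SAME
  shape (`2L(L−1) + 2 ≤ 2L²`, `L(L−1)(2 + (L−1)²) + 1 ≤ L⁴`); and its absorbed form `massBound_small`: if `2d³(n²θ)² ≤ 1` then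
  `N^{−1}Σ|φ|² ≤ 2Σ_y|(Q_k(u)φ)(y)|² + 4(n²/N)Σ_b|u_bφ(b₊) − φ(b₋)|²`.
HONEST SCOPE.  A `u`-uniform estimate in terms of `θ = max_p‖u(∂p) − 1‖` for an arbitrary `U(1)` field; at `θ = 0` (flat / pure gauge) it is the
`k`-level block Poincaré inequality with constant independent of `k`.  Nothing is claimed about the `θ` of the background `u_k` of (4.5.4).
-/

open scoped BigOperators
open Finset

namespace Literature.MathematicalPhysics.QuantumFieldTheory.BalabanImbrieJaffe1984to88.BIJ85CovariantPoincare

open Literature.MathematicalPhysics.QuantumFieldTheory.Balaban1983to89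
open BIJ88Sect3Statements (U1 toC toC_one toC_mul norm_toC)
open BIJ85Sect1Model (HiggsField)
open BIJ88RenormTransf311 (inBlock)
open BIJ85BlockAveragesTorus BIJ85BlockAveragesTorusK BIJ85BlockAveragingIneq BIJ85BlockAveragingIneqCov BIJ85AbelianStokes
open BIJ85HolonomyDefect
open Beta.BlockPoincare (avg sum_sq_eq_var_add)
open Beta.CoordCubePoincare (stepUp blockPoincare_of_charts)

noncomputable section

variable {P : Params} {i : ℕ}

/-! ## §1 The one-level block Poincaré inequality on the torus (real functions; the chart of gen 4's `BIJ85FluctuationCovarianceFlatBounds` §1, as a term) -/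

/-- `(L − 1) + 1 = L`. [folklore] -/
private theorem predL_succ (P : Params) : P.L - 1 + 1 = P.L := Nat.sub_add_cancel P.L_pos

/-- Block Poincaré for a real function on ONE block of the torus (the β-cell's `blockPoincare_of_charts` through the chart
`{0,…,L−1}^d → B(y)`, `r ↦ blockSite y r` — written as a term, so that this file declares theorems only; constant `L(L−1)/2`, bonds with
both ends in the block; the same instance as gen 4's `BIJ85FluctuationCovarianceFlatBounds` §1). [folklore] -/
private theorem var_block_le (hi : i + 1 ≤ P.m + P.K) (y : Balaban1983to89.Site P (i+1)) (f : Balaban1983to89.Site P i → ℝ) :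
    ∑ x ∈ block y, (f x - avg (block y) f) ^ 2
      ≤ (P.L : ℝ) * ((P.L : ℝ) - 1) / 2 *
        ∑ b ∈ univ.filter (fun b : PBond P i => blockOf b.src = y ∧ blockOf b.tgt = y), (f b.tgt - f b.src) ^ 2 := by
  classical
  have hC' : ((P.L - 1 : ℕ) : ℝ) * ((P.L - 1 : ℕ) + 1) / 2 = (P.L : ℝ) * ((P.L : ℝ) - 1) / 2 := by
    rw [Nat.cast_pred P.L_pos]; ring
  rw [← hC']
  -- the chart r ↦ blockSite y (r.cast): injective, jointly onto, unit steps inside the cube are unit steps on the torus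
  have hinj : ∀ y' : Balaban1983to89.Site P (i+1), Function.Injective
      (fun r : Fin P.d → Fin (P.L - 1 + 1) => Balaban1983to89.Site.blockSite y' (fun κ => (r κ).cast (predL_succ P))) := by
    intro y' r r' h
    funext κ
    have hv := congrArg (fun x : Balaban1983to89.Site P i => (x κ).val) h
    simp only [Balaban1983to89.Site.val_blockSite hi, Fin.val_cast, add_right_inj] at hv
    exact Fin.ext hv
  have hsurj : ∀ x : Balaban1983to89.Site P i, ∃ r : Fin P.d → Fin (P.L - 1 + 1),
      Balaban1983to89.Site.blockSite (blockOf x) (fun κ => (r κ).cast (predL_succ P)) = x := fun x =>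
    ⟨fun κ => (offs x κ).cast (predL_succ P).symm, by
      have h : (fun κ => ((offs x κ).cast (predL_succ P).symm).cast (predL_succ P)) = offs x := funext fun κ => Fin.ext rfl
      simp only [h]
      exact blockSite_offs hi x⟩
  have hstep : ∀ (y' : Balaban1983to89.Site P (i+1)) (μ : Fin P.d) (r : Fin P.d → Fin (P.L - 1 + 1)),
      r μ ≠ Fin.last (P.L - 1) →
      (Balaban1983to89.Site.blockSite y' (fun κ => (r κ).cast (predL_succ P))).shift μ
        = Balaban1983to89.Site.blockSite y' (fun κ => (stepUp r μ κ).cast (predL_succ P)) := by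
    intro y' μ r hr
    funext κ
    simp only [Balaban1983to89.Site.shift, Balaban1983to89.Site.blockSite, stepUp]
    by_cases hκ : κ = μ
    · subst hκ
      simp only [Function.update_self, Fin.val_cast, Fin.val_add_one, if_neg hr]
      push_cast
      ring
    · simp only [Function.update_of_ne hκ, Balaban1983to89.Site.blockSite, Fin.val_cast]
  exact blockPoincare_of_charts blockOf PBond.src PBond.tgt (P.L - 1) P.d
    (fun y' r => Balaban1983to89.Site.blockSite y' (fun κ => (r κ).cast (predL_succ P)))
    (fun y' _ => Balaban1983to89.Site.blockOf_blockSite hi y' _) hinj hsurj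
    (fun y' μ r => ⟨Balaban1983to89.Site.blockSite y' (fun κ => (r κ).cast (predL_succ P)), μ⟩)
    (fun _ _ _ _ => rfl) (fun y' μ r hr => hstep y' μ r hr)
    (fun y' p hp p' hp' h => by
      simp only [PBond.mk.injEq] at h
      exact Prod.ext h.2 (hinj y' h.1)) y f

/-! ## §2 Complex functions: the block mean, Steiner, Poincaré -/

/-- kernel: the real and imaginary parts of the block mean `L^{−d}Σ_{x∈B(y)} g(x)` are the block means of those of `g`.
[cite: BalabanImbrieJaffe1985, (2.6) p.303] -/
theorem re_im_blockMean (hi : i + 1 ≤ P.m + P.K) (y : Balaban1983to89.Site P (i+1)) (g : Balaban1983to89.Site P i → ℂ) :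
    (((P.L : ℂ) ^ P.d)⁻¹ * ∑ x ∈ block y, g x).re = avg (block y) (fun x => (g x).re)
      ∧ (((P.L : ℂ) ^ P.d)⁻¹ * ∑ x ∈ block y, g x).im = avg (block y) (fun x => (g x).im) := by
  have h1 : ((P.L : ℂ) ^ P.d)⁻¹ * ∑ x ∈ block y, g x = ((((P.L : ℝ) ^ P.d)⁻¹ : ℝ) : ℂ) * ∑ x ∈ block y, g x := by
    push_cast; rfl
  rw [h1, Complex.re_ofReal_mul, Complex.re_sum, Complex.im_ofReal_mul, Complex.im_sum, avg, avg,
    Balaban1983to89.Site.card_block hi, Nat.cast_pow, div_eq_inv_mul, div_eq_inv_mul]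
  exact ⟨rfl, rfl⟩

/-- **Steiner on a block** for a complex function: `Σ_{x∈B(y)}|g(x)|² = L^d·|m|² + Σ_{x∈B(y)}|g(x) − m|²`, `m = L^{−d}Σ_{x∈B(y)}g(x)` the block
mean. [cite: BalabanImbrieJaffe1985, (2.6) p.303] -/
theorem sum_norm_sq_block_eq (hi : i + 1 ≤ P.m + P.K) (y : Balaban1983to89.Site P (i+1)) (g : Balaban1983to89.Site P i → ℂ) :
    ∑ x ∈ block y, ‖g x‖ ^ 2
      = (P.L : ℝ) ^ P.d * ‖((P.L : ℂ) ^ P.d)⁻¹ * ∑ x ∈ block y, g x‖ ^ 2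
        + ∑ x ∈ block y, ‖g x - ((P.L : ℂ) ^ P.d)⁻¹ * ∑ x ∈ block y, g x‖ ^ 2 := by
  set m : ℂ := ((P.L : ℂ) ^ P.d)⁻¹ * ∑ x ∈ block y, g x with hm
  set fR : Balaban1983to89.Site P i → ℝ := fun x => (g x).re with hfR
  set fI : Balaban1983to89.Site P i → ℝ := fun x => (g x).im with hfI
  obtain ⟨hre, him⟩ := re_im_blockMean hi y g
  rw [← hm] at hre him
  have hL : ∀ x, ‖g x‖ ^ 2 = fR x ^ 2 + fI x ^ 2 := fun x => by
    rw [Complex.sq_norm, Complex.normSq_apply, hfR, hfI]; ring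
  have hD : ∀ x, ‖g x - m‖ ^ 2 = (fR x - m.re) ^ 2 + (fI x - m.im) ^ 2 := fun x => by
    rw [Complex.sq_norm, Complex.normSq_apply, Complex.sub_re, Complex.sub_im, hfR, hfI]; ring
  have hM : ‖m‖ ^ 2 = m.re ^ 2 + m.im ^ 2 := by rw [Complex.sq_norm, Complex.normSq_apply]; ring
  simp only [hL, hD, hM, sum_add_distrib]
  rw [sum_sq_eq_var_add (block y) fR, sum_sq_eq_var_add (block y) fI, hre, him, Balaban1983to89.Site.card_block hi, Nat.cast_pow]
  ring

/-- **Block Poincaré for a complex function**: `Σ_{x∈B(y)}|g(x) − m|² ≤ (L(L−1)/2)·Σ_{b⊂B(y)}|g(b₊) − g(b₋)|²`, `m` the block mean (the real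
inequality for `Re g` and `Im g`). [cite: BalabanImbrieJaffe1985, (2.6) p.303] -/
theorem var_block_le_complex (hi : i + 1 ≤ P.m + P.K) (y : Balaban1983to89.Site P (i+1)) (g : Balaban1983to89.Site P i → ℂ) :
    ∑ x ∈ block y, ‖g x - ((P.L : ℂ) ^ P.d)⁻¹ * ∑ x ∈ block y, g x‖ ^ 2
      ≤ (P.L : ℝ) * ((P.L : ℝ) - 1) / 2 *
        ∑ b ∈ univ.filter (fun b : PBond P i => blockOf b.src = y ∧ blockOf b.tgt = y), ‖g b.tgt - g b.src‖ ^ 2 := by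
  set m : ℂ := ((P.L : ℂ) ^ P.d)⁻¹ * ∑ x ∈ block y, g x with hm
  set fR : Balaban1983to89.Site P i → ℝ := fun x => (g x).re with hfR
  set fI : Balaban1983to89.Site P i → ℝ := fun x => (g x).im with hfI
  obtain ⟨hre, him⟩ := re_im_blockMean hi y g
  rw [← hm] at hre him
  have hD : ∀ x, ‖g x - m‖ ^ 2 = (fR x - m.re) ^ 2 + (fI x - m.im) ^ 2 := fun x => by
    rw [Complex.sq_norm, Complex.normSq_apply, Complex.sub_re, Complex.sub_im, hfR, hfI]; ring
  have hB : ∀ b : PBond P i, ‖g b.tgt - g b.src‖ ^ 2 = (fR b.tgt - fR b.src) ^ 2 + (fI b.tgt - fI b.src) ^ 2 := fun b => by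
    rw [Complex.sq_norm, Complex.normSq_apply, Complex.sub_re, Complex.sub_im, hfR, hfI]; ring
  simp only [hD, hB, sum_add_distrib, mul_add]
  rw [hre, him]
  exact add_le_add (var_block_le hi y fR) (var_block_le hi y fI)

/-! ## §3 The tree gauge `g(x) = u(Γ_{yx})φ(x)`: its gradient on in-block bonds -/

/-- kernel: `y + e_μ ≠ y` on the torus (at least two sites per direction). [cite: Balaban1987RG1, (0.1) p.251] -/
private theorem shift_ne_self {i' : ℕ} (z : Balaban1983to89.Site P i') (μ : Fin P.d) : z.shift μ ≠ z := by
  intro h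
  have h1 := congrFun h μ
  simp only [Balaban1983to89.Site.shift, Function.update_self, add_eq_left] at h1
  exact one_ne_zero h1

/-- kernel: a bond with both ends in the same block is an in-block bond in the sense of file 2, `inBlock b₋ (dir b) + 1 < L` (a crossing bond
ends in the next block, r18's `blockOf_tgt_of_isCross`; standing range). [cite: BalabanImbrieJaffe1985, (2.4) p.302] -/
theorem inBlock_lt_of_blockOf_eq (hi : i + 1 ≤ P.m + P.K) {b : PBond P i} (hb : blockOf b.tgt = blockOf b.src) :
    inBlock b.src b.dir + 1 < P.L := by
  have hlt : inBlock b.src b.dir < P.L := Nat.mod_lt _ P.L_pos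
  by_contra hc
  have hcross : IsCross b := by unfold IsCross; omega
  have h := blockOf_tgt_of_isCross hi hcross
  rw [hb] at h
  exact shift_ne_self _ _ h.symm

/-- **The tree-gauge gradient**: for an in-block bond `b = ⟨w, w+e_ν⟩` and `g = u(Γ_{y·})φ`,
`|g(b₊) − g(b₋)|² ≤ 2|u_bφ(b₊) − φ(b₋)|² + 2(d(L−1)θ)²|φ(b₊)|²` — from `g(b₊) − g(b₋) = u(Γ_{yb₊})(1 − ρ_b)φ(b₊) + u(Γ_{yb₋})(u_bφ(b₊) − φ(b₋))`
with `ρ_b = u(Γ_{yb₊})^{−1}u(Γ_{yb₋})u_b` the tree loop of file 2 (`‖ρ_b − 1‖ ≤ d(L−1)θ`; standing range).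
[cite: BalabanImbrieJaffe1985, (7.3.1) p.326] -/
theorem norm_treeGrad_sq_le (hi : i + 1 ≤ P.m + P.K) (V : GaugeField P i U1) {θ : ℝ}
    (hθ : ∀ (x : Balaban1983to89.Site P i) (μ ν : Fin P.d), ‖plaqC V x μ ν - 1‖ ≤ θ)
    (φ : Balaban1983to89.Site P i → ℂ) {b : PBond P i} (hb : inBlock b.src b.dir + 1 < P.L) :
    ‖holC V b.tgt * φ b.tgt - holC V b.src * φ b.src‖ ^ 2
      ≤ 2 * ‖toC (V b) * φ b.tgt - φ b.src‖ ^ 2 + 2 * ((P.d * ((P.L : ℝ) - 1) * θ) ^ 2 * ‖φ b.tgt‖ ^ 2) := by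
  have hθ0 : 0 ≤ θ := (norm_nonneg _).trans (hθ b.src b.dir b.dir)
  set h' : ℂ := holC V b.tgt
  set h : ℂ := holC V b.src
  set u : ℂ := toC (V b)
  have hne : h' ≠ 0 := holC_ne_zero _ _
  have e : h' * φ b.tgt - h * φ b.src = h' * ((1 - h'⁻¹ * h * u) * φ b.tgt) + h * (u * φ b.tgt - φ b.src) := by
    field_simp
    ring
  have hρ : ‖h'⁻¹ * h * u - 1‖ ≤ P.d * ((P.L : ℝ) - 1) * θ :=
    norm_treeLoop_sub_one_le hi V hθ (w := b.src) (ν := b.dir) hb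
  rw [e]
  have h1 : ‖h' * ((1 - h'⁻¹ * h * u) * φ b.tgt) + h * (u * φ b.tgt - φ b.src)‖
      ≤ ‖1 - h'⁻¹ * h * u‖ * ‖φ b.tgt‖ + ‖u * φ b.tgt - φ b.src‖ := by
    refine (norm_add_le _ _).trans ?_
    rw [norm_mul, norm_mul, norm_mul, norm_holC, norm_holC, one_mul, one_mul]
  have h2 : ‖1 - h'⁻¹ * h * u‖ ≤ P.d * ((P.L : ℝ) - 1) * θ := by rw [norm_sub_rev]; exact hρ
  have h3 : ‖1 - h'⁻¹ * h * u‖ * ‖φ b.tgt‖ ≤ P.d * ((P.L : ℝ) - 1) * θ * ‖φ b.tgt‖ :=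
    mul_le_mul_of_nonneg_right h2 (norm_nonneg _)
  have h4 : ‖h' * ((1 - h'⁻¹ * h * u) * φ b.tgt) + h * (u * φ b.tgt - φ b.src)‖
      ≤ P.d * ((P.L : ℝ) - 1) * θ * ‖φ b.tgt‖ + ‖u * φ b.tgt - φ b.src‖ := by linarith
  have h5 : (P.d * ((P.L : ℝ) - 1) * θ * ‖φ b.tgt‖ + ‖u * φ b.tgt - φ b.src‖) ^ 2
      ≤ 2 * ‖u * φ b.tgt - φ b.src‖ ^ 2 + 2 * ((P.d * ((P.L : ℝ) - 1) * θ) ^ 2 * ‖φ b.tgt‖ ^ 2) := by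
    nlinarith [sq_nonneg (P.d * ((P.L : ℝ) - 1) * θ * ‖φ b.tgt‖ - ‖u * φ b.tgt - φ b.src‖)]
  exact (pow_le_pow_left₀ (norm_nonneg _) h4 2).trans h5

/-! ## §4 The one-level COVARIANT block Poincaré inequality with defect -/

/-- **One block**: for every `U(1)` field `u` with plaquettes within `θ` of `1`, every `φ` and every block `B(y)` (standing range),
`Σ_{x∈B(y)}|φ(x)|² ≤ L^d|(Q(u)φ)(y)|² + L(L−1)·Σ_{b⊂B(y)}(|u_bφ(b₊) − φ(b₋)|² + (d(L−1)θ)²|φ(b₊)|²)` — Steiner in the tree gauge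
`g = u(Γ_{y·})φ` (block mean `= (Q(u)φ)(y)` by (2.6)), the cube Poincaré inequality, and the tree-gauge gradient bound.
[cite: BalabanImbrieJaffe1985, (7.3.2) p.326] -/
theorem covPoincare_block (hi : i + 1 ≤ P.m + P.K) (V : GaugeField P i U1) {θ : ℝ}
    (hθ : ∀ (x : Balaban1983to89.Site P i) (μ ν : Fin P.d), ‖plaqC V x μ ν - 1‖ ≤ θ)
    (φ : Balaban1983to89.Site P i → ℂ) (y : Balaban1983to89.Site P (i+1)) :
    ∑ x ∈ block y, ‖φ x‖ ^ 2
      ≤ (P.L : ℝ) ^ P.d * ‖qCov V φ y‖ ^ 2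
        + (P.L : ℝ) * ((P.L : ℝ) - 1) *
          ∑ b ∈ univ.filter (fun b : PBond P i => blockOf b.src = y ∧ blockOf b.tgt = y),
            (‖toC (V b) * φ b.tgt - φ b.src‖ ^ 2 + (P.d * ((P.L : ℝ) - 1) * θ) ^ 2 * ‖φ b.tgt‖ ^ 2) := by
  set g : Balaban1983to89.Site P i → ℂ := fun x => holC V x * φ x with hg
  have hng : ∀ x, ‖φ x‖ ^ 2 = ‖g x‖ ^ 2 := fun x => by rw [hg, norm_mul, norm_holC, one_mul]
  have hmean : ((P.L : ℂ) ^ P.d)⁻¹ * ∑ x ∈ block y, g x = qCov V φ y := by rw [qCov_apply]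
  have hC : 0 ≤ (P.L : ℝ) * ((P.L : ℝ) - 1) := by
    have h1 : (1 : ℝ) ≤ P.L := by exact_mod_cast P.L_pos
    nlinarith
  rw [sum_congr rfl fun x _ => hng x, sum_norm_sq_block_eq hi y g, hmean]
  have hvar := var_block_le_complex hi y g
  rw [hmean] at hvar
  refine add_le_add le_rfl (hvar.trans ?_)
  calc (P.L : ℝ) * ((P.L : ℝ) - 1) / 2
        * ∑ b ∈ univ.filter (fun b : PBond P i => blockOf b.src = y ∧ blockOf b.tgt = y), ‖g b.tgt - g b.src‖ ^ 2
      ≤ (P.L : ℝ) * ((P.L : ℝ) - 1) / 2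
        * ∑ b ∈ univ.filter (fun b : PBond P i => blockOf b.src = y ∧ blockOf b.tgt = y),
            (2 * ‖toC (V b) * φ b.tgt - φ b.src‖ ^ 2 + 2 * ((P.d * ((P.L : ℝ) - 1) * θ) ^ 2 * ‖φ b.tgt‖ ^ 2)) := by
        refine mul_le_mul_of_nonneg_left (sum_le_sum fun b hb => ?_) (div_nonneg hC (by norm_num))
        have hb' : blockOf b.tgt = blockOf b.src := by
          simp only [mem_filter, mem_univ, true_and] at hb
          rw [hb.1, hb.2]
        exact norm_treeGrad_sq_le hi V hθ φ (inBlock_lt_of_blockOf_eq hi hb')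
    _ = _ := by
        rw [mul_sum, mul_sum]
        refine sum_congr rfl fun b _ => ?_
        ring

/-- **THE ONE-LEVEL COVARIANT BLOCK POINCARÉ INEQUALITY WITH DEFECT**, every `U(1)` field `u` on `T^{(i)}` (`i + 1 ≤ m + K`) with
plaquettes within `θ` of `1`, every `φ : T^{(i)} → ℂ`:
`Σ_x|φ(x)|² ≤ L^dΣ_y|(Q(u)φ)(y)|² + L(L−1)·[Σ_b|u_bφ(b₊) − φ(b₋)|² + d(d(L−1)θ)²Σ_x|φ(x)|²]` (blocks partition the torus; in-block bonds are
bonds; every site ends `d` bonds). [cite: BalabanImbrieJaffe1985, (7.3.2) p.326] -/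
theorem covPoincare_oneLevel (hi : i + 1 ≤ P.m + P.K) (V : GaugeField P i U1) {θ : ℝ}
    (hθ : ∀ (x : Balaban1983to89.Site P i) (μ ν : Fin P.d), ‖plaqC V x μ ν - 1‖ ≤ θ)
    (φ : Balaban1983to89.Site P i → ℂ) :
    ∑ x : Balaban1983to89.Site P i, ‖φ x‖ ^ 2
      ≤ (P.L : ℝ) ^ P.d * ∑ y : Balaban1983to89.Site P (i+1), ‖qCov V φ y‖ ^ 2
        + (P.L : ℝ) * ((P.L : ℝ) - 1) *
          (∑ b : PBond P i, ‖toC (V b) * φ b.tgt - φ b.src‖ ^ 2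
            + P.d * (P.d * ((P.L : ℝ) - 1) * θ) ^ 2 * ∑ x : Balaban1983to89.Site P i, ‖φ x‖ ^ 2) := by
  have hC : 0 ≤ (P.L : ℝ) * ((P.L : ℝ) - 1) := by
    have h1 : (1 : ℝ) ≤ P.L := by exact_mod_cast P.L_pos
    nlinarith
  set F : PBond P i → ℝ := fun b => ‖toC (V b) * φ b.tgt - φ b.src‖ ^ 2 + (P.d * ((P.L : ℝ) - 1) * θ) ^ 2 * ‖φ b.tgt‖ ^ 2 with hF
  have hF0 : ∀ b, 0 ≤ F b := fun b => by positivity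
  -- in-block bonds, summed over the blocks, are dominated by all bonds
  have hbonds : ∑ y : Balaban1983to89.Site P (i+1),
      ∑ b ∈ univ.filter (fun b : PBond P i => blockOf b.src = y ∧ blockOf b.tgt = y), F b ≤ ∑ b : PBond P i, F b := by
    calc ∑ y : Balaban1983to89.Site P (i+1), ∑ b ∈ univ.filter (fun b : PBond P i => blockOf b.src = y ∧ blockOf b.tgt = y), F b
        ≤ ∑ y : Balaban1983to89.Site P (i+1), ∑ b ∈ univ.filter (fun b : PBond P i => blockOf b.src = y), F b :=
          sum_le_sum fun y _ => sum_le_sum_of_subset_of_nonneg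
            (fun b hb => by simp only [mem_filter, mem_univ, true_and] at hb ⊢; exact hb.1) fun b _ _ => hF0 b
      _ = ∑ b : PBond P i, F b := sum_fiberwise univ (fun b : PBond P i => blockOf b.src) F
  -- Σ_b F b = E + d·(dLθ)²·Σ|φ|²
  have hsumF : ∑ b : PBond P i, F b
      = ∑ b : PBond P i, ‖toC (V b) * φ b.tgt - φ b.src‖ ^ 2
        + P.d * (P.d * ((P.L : ℝ) - 1) * θ) ^ 2 * ∑ x : Balaban1983to89.Site P i, ‖φ x‖ ^ 2 := by
    simp only [hF, sum_add_distrib, ← mul_sum]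
    congr 1
    rw [sum_bond_eq (fun b : PBond P i => ‖φ b.tgt‖ ^ 2)]
    have e : ∑ x : Balaban1983to89.Site P i, ∑ μ : Fin P.d, ‖φ (PBond.tgt ⟨x, μ⟩)‖ ^ 2
        = ∑ x : Balaban1983to89.Site P i, ∑ μ : Fin P.d, ‖φ (x.shift μ)‖ ^ 2 := rfl
    rw [e, sum_sum_shift_dir (fun x => ‖φ x‖ ^ 2)]
    ring
  calc ∑ x : Balaban1983to89.Site P i, ‖φ x‖ ^ 2
      = ∑ y : Balaban1983to89.Site P (i+1), ∑ x ∈ block y, ‖φ x‖ ^ 2 :=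
        (sum_fiberwise univ (fun x : Balaban1983to89.Site P i => blockOf x) (fun x => ‖φ x‖ ^ 2)).symm
    _ ≤ ∑ y : Balaban1983to89.Site P (i+1), ((P.L : ℝ) ^ P.d * ‖qCov V φ y‖ ^ 2
        + (P.L : ℝ) * ((P.L : ℝ) - 1) *
          ∑ b ∈ univ.filter (fun b : PBond P i => blockOf b.src = y ∧ blockOf b.tgt = y), F b) :=
        sum_le_sum fun y _ => covPoincare_block hi V hθ φ y
    _ = (P.L : ℝ) ^ P.d * ∑ y : Balaban1983to89.Site P (i+1), ‖qCov V φ y‖ ^ 2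
        + (P.L : ℝ) * ((P.L : ℝ) - 1) * ∑ y : Balaban1983to89.Site P (i+1),
            ∑ b ∈ univ.filter (fun b : PBond P i => blockOf b.src = y ∧ blockOf b.tgt = y), F b := by
        rw [sum_add_distrib, ← mul_sum, ← mul_sum]
    _ ≤ _ := by
        rw [← hsumF]
        exact add_le_add le_rfl (mul_le_mul_of_nonneg_left hbonds hC)

/-! ## §5 The multiscale mass bound at level `k` -/

variable {j : ℕ}

/-- Jensen / Cauchy–Schwarz on a finite set: `|Σ_{x∈S} a_x|² ≤ |S|·Σ_{x∈S}|a_x|²`. [cite: BalabanImbrieJaffe1985, (2.6) p.303] -/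
private theorem norm_sum_sq_le_card_mul {ι : Type*} (S : Finset ι) (a : ι → ℂ) :
    ‖∑ x ∈ S, a x‖ ^ 2 ≤ S.card * ∑ x ∈ S, ‖a x‖ ^ 2 :=
  calc ‖∑ x ∈ S, a x‖ ^ 2 ≤ (∑ x ∈ S, ‖a x‖) ^ 2 := pow_le_pow_left₀ (norm_nonneg _) (norm_sum_le _ _) 2
    _ ≤ S.card * ∑ x ∈ S, ‖a x‖ ^ 2 := sq_sum_le_card_mul_sum_sq

/-- **Jensen for the `k`-fold covariant average**: `Σ_y|(Q_i(u)φ)(y)|² ≤ L^{−id}Σ_x|φ(x)|²` (`|u(Γ^{(i)})| = 1`, `|B^i(y)| = L^{id}`; standing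
range). [cite: BalabanImbrieJaffe1985, (2.6) p.303] -/
theorem sum_norm_qCovK_sq_le {k : ℕ} (hk : j + k ≤ P.m + P.K) (U : GaugeField P j U1) (φ : HiggsField P j) :
    ∑ y : Balaban1983to89.Site P (j+k), ‖qCovK U k φ y‖ ^ 2
      ≤ ((P.L : ℝ) ^ (k * P.d))⁻¹ * ∑ x : Balaban1983to89.Site P j, ‖φ x‖ ^ 2 := by
  have hN : (0 : ℝ) < (P.L : ℝ) ^ (k * P.d) := pow_pos (Nat.cast_pos.2 P.L_pos) _
  have hy : ∀ y : Balaban1983to89.Site P (j+k),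
      ‖qCovK U k φ y‖ ^ 2 ≤ ((P.L : ℝ) ^ (k * P.d))⁻¹ * ∑ x ∈ blockK k y, ‖φ x‖ ^ 2 := by
    intro y
    rw [qCovK_apply, norm_mul, mul_pow, norm_inv, norm_pow, Complex.norm_natCast]
    have h1 := norm_sum_sq_le_card_mul (blockK k y) (fun x => holCK U k x * φ x)
    rw [card_blockK k hk y, Nat.cast_pow] at h1
    simp only [norm_mul, norm_holCK, one_mul] at h1
    calc ((P.L : ℝ) ^ (k * P.d))⁻¹ ^ 2 * ‖∑ x ∈ blockK k y, holCK U k x * φ x‖ ^ 2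
        ≤ ((P.L : ℝ) ^ (k * P.d))⁻¹ ^ 2 * ((P.L : ℝ) ^ (k * P.d) * ∑ x ∈ blockK k y, ‖φ x‖ ^ 2) :=
          mul_le_mul_of_nonneg_left h1 (by positivity)
      _ = _ := by field_simp
  calc ∑ y : Balaban1983to89.Site P (j+k), ‖qCovK U k φ y‖ ^ 2
      ≤ ∑ y : Balaban1983to89.Site P (j+k), ((P.L : ℝ) ^ (k * P.d))⁻¹ * ∑ x ∈ blockK k y, ‖φ x‖ ^ 2 := sum_le_sum fun y _ => hy y
    _ = _ := by rw [← mul_sum, sum_blockK_sum]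

/-- Sums over the torus are invariant under the translation `x ↦ x + ne_μ` (a bijection of the finite torus).
[cite: BalabanImbrieJaffe1985, (2.2) p.302] -/
private theorem sum_runSite_eq {α : Type*} [AddCommMonoid α] (μ : Fin P.d) (n : ℕ) (F : Balaban1983to89.Site P j → α) :
    ∑ x : Balaban1983to89.Site P j, F (runSite x μ n) = ∑ x : Balaban1983to89.Site P j, F x := by
  refine Fintype.sum_bijective _ (Finite.injective_iff_bijective.1 fun x y h => ?_) _ _ fun _ => rfl
  funext κ
  have hκ := congrFun h κ
  by_cases e : κ = μ
  · subst e
    simpa only [runSite, Function.update_self, add_left_inj] using hκ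
  · simpa only [runSite, Function.update_of_ne e] using hκ

/-- **The level-`i` bond form of `Q_i(u)φ` with the defect EVALUATED**: for every `u` with plaquettes within `θ` of `1` (`j + i ≤ m + K`),
`Σ_{b⊂T^{(i)}}|u^{(i)}_b(Q_iφ)(b₊) − (Q_iφ)(b₋)|² ≤ 2(L^{2i}/L^{id})Σ_b|u_bφ(b₊) − φ(b₋)|² + 2d³(L^{2i})²θ²·L^{−id}Σ_x|φ(x)|²` — gen 4's
covariant block-averaging inequality with `W = lineIter u i`, its defect bounded by file 2 (`dL^i(L^i−1)θ ≤ dL^{2i}θ`), and the translation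
invariance of `Σ_x|φ(x+ne_μ)|²`. [cite: BalabanImbrieJaffe1985, (7.3.2) p.326] -/
theorem bondForm_qCovK_le {k : ℕ} (hk : j + k ≤ P.m + P.K) (U : GaugeField P j U1) {θ : ℝ}
    (hθ : ∀ (x : Balaban1983to89.Site P j) (μ ν : Fin P.d), ‖plaqC U x μ ν - 1‖ ≤ θ) (φ : HiggsField P j) :
    ∑ b : PBond P (j+k), ‖toC (lineIter U k b) * qCovK U k φ b.tgt - qCovK U k φ b.src‖ ^ 2
      ≤ 2 * (((P.L : ℝ) ^ k) ^ 2 / (P.L : ℝ) ^ (k * P.d)) * ∑ b : PBond P j, ‖toC (U b) * φ b.tgt - φ b.src‖ ^ 2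
        + 2 * (P.d : ℝ) ^ 3 * (((P.L : ℝ) ^ k) ^ 2 * θ) ^ 2 * (((P.L : ℝ) ^ (k * P.d))⁻¹
            * ∑ x : Balaban1983to89.Site P j, ‖φ x‖ ^ 2) := by
  have hθ0 : 0 ≤ θ := (norm_nonneg _).trans (hθ default ⟨0, P.hd⟩ ⟨0, P.hd⟩)
  have hN : (0 : ℝ) < (P.L : ℝ) ^ (k * P.d) := pow_pos (Nat.cast_pos.2 P.L_pos) _
  have hn1 : (1 : ℝ) ≤ (P.L : ℝ) ^ k := one_le_pow₀ (by exact_mod_cast P.L_pos)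
  have h := sum_norm_qCovK_shift_sub_sq_le_cov hk U (lineIter U k) φ
  rw [sum_bond_eq (fun b : PBond P (j+k) => ‖toC (lineIter U k b) * qCovK U k φ b.tgt - qCovK U k φ b.src‖ ^ 2)]
  refine h.trans (add_le_add le_rfl ?_)
  -- the defect term
  have hρ : ∀ (x : Balaban1983to89.Site P j) (μ : Fin P.d),
      ‖(holCK U k x)⁻¹ * toC (lineIter U k ⟨blkIter k x, μ⟩) * holCK U k (runSite x μ (P.L ^ k))
          * (toC (runProd U x μ (P.L ^ k)))⁻¹ - 1‖ ^ 2 ≤ ((P.d : ℝ) * ((P.L : ℝ) ^ k) ^ 2 * θ) ^ 2 := by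
    intro x μ
    have h1 := norm_blockContourDefect_sub_one_le' hk U hθ x μ
    have h2 : (P.d : ℝ) * (P.L : ℝ) ^ k * ((P.L : ℝ) ^ k - 1) * θ ≤ P.d * ((P.L : ℝ) ^ k) ^ 2 * θ := by
      have : (P.L : ℝ) ^ k * ((P.L : ℝ) ^ k - 1) ≤ ((P.L : ℝ) ^ k) ^ 2 := by nlinarith
      have hd : (0 : ℝ) ≤ P.d := Nat.cast_nonneg _
      nlinarith [mul_nonneg hd hθ0]
    exact pow_le_pow_left₀ (norm_nonneg _) (h1.trans h2) 2
  calc 2 * ((P.L : ℝ) ^ (k * P.d))⁻¹ * ∑ x : Balaban1983to89.Site P j, ∑ μ : Fin P.d,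
          ‖(holCK U k x)⁻¹ * toC (lineIter U k ⟨blkIter k x, μ⟩) * holCK U k (runSite x μ (P.L ^ k))
              * (toC (runProd U x μ (P.L ^ k)))⁻¹ - 1‖ ^ 2 * ‖φ (runSite x μ (P.L ^ k))‖ ^ 2
      ≤ 2 * ((P.L : ℝ) ^ (k * P.d))⁻¹ * ∑ x : Balaban1983to89.Site P j, ∑ μ : Fin P.d,
          ((P.d : ℝ) * ((P.L : ℝ) ^ k) ^ 2 * θ) ^ 2 * ‖φ (runSite x μ (P.L ^ k))‖ ^ 2 := by
        refine mul_le_mul_of_nonneg_left (sum_le_sum fun x _ => sum_le_sum fun μ _ => ?_) (by positivity)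
        exact mul_le_mul_of_nonneg_right (hρ x μ) (by positivity)
    _ = 2 * ((P.L : ℝ) ^ (k * P.d))⁻¹ * (((P.d : ℝ) * ((P.L : ℝ) ^ k) ^ 2 * θ) ^ 2
          * (P.d * ∑ x : Balaban1983to89.Site P j, ‖φ x‖ ^ 2)) := by
        congr 1
        calc ∑ x : Balaban1983to89.Site P j, ∑ μ : Fin P.d,
              ((P.d : ℝ) * ((P.L : ℝ) ^ k) ^ 2 * θ) ^ 2 * ‖φ (runSite x μ (P.L ^ k))‖ ^ 2
            = ∑ μ : Fin P.d, ∑ x : Balaban1983to89.Site P j,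
                ((P.d : ℝ) * ((P.L : ℝ) ^ k) ^ 2 * θ) ^ 2 * ‖φ (runSite x μ (P.L ^ k))‖ ^ 2 := sum_comm
          _ = ∑ μ : Fin P.d, ∑ x : Balaban1983to89.Site P j, ((P.d : ℝ) * ((P.L : ℝ) ^ k) ^ 2 * θ) ^ 2 * ‖φ x‖ ^ 2 :=
              sum_congr rfl fun μ _ => sum_runSite_eq μ (P.L ^ k)
                (fun x => ((P.d : ℝ) * ((P.L : ℝ) ^ k) ^ 2 * θ) ^ 2 * ‖φ x‖ ^ 2)
          _ = ∑ _μ : Fin P.d, ((P.d : ℝ) * ((P.L : ℝ) ^ k) ^ 2 * θ) ^ 2 * ∑ x : Balaban1983to89.Site P j, ‖φ x‖ ^ 2 := by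
              simp_rw [mul_sum]
          _ = _ := by
              rw [sum_const, card_univ, Fintype.card_fin, nsmul_eq_mul]
              ring
    _ = _ := by ring

/-- kernel (the real-variable bookkeeping of one telescoping step): from the level-`i` mass bound `Q_i`, the one-level covariant Poincaré
inequality at level `i`, the level-`i` bond-form bound and Jensen, the level-`(i+1)` mass bound `Q_{i+1}` follows with the SAME shape
(`2L(L−1) + 2 ≤ 2L²`, `L(L−1)(2 + (L−1)²) + 1 ≤ L⁴`). [cite: BalabanImbrieJaffe1985, (7.3.2) p.326] -/
theorem massBound_step_real {a L Ni ni θ d S0 Si Si1 E Ei : ℝ} (hL : 1 ≤ L) (ha : 0 < a) (hNi : 0 < Ni)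
    (hd : 0 ≤ d) (hS0 : 0 ≤ S0) (hE : 0 ≤ E)
    (hQ : Ni⁻¹ * S0 ≤ Si + 2 * ni ^ 2 * Ni⁻¹ * E + d ^ 3 * (ni ^ 2 * θ) ^ 2 * (Ni⁻¹ * S0))
    (hstar : Si ≤ a * Si1 + L * (L - 1) * (Ei + d * (d * (L - 1) * (ni ^ 2 * θ)) ^ 2 * Si))
    (hB : Ei ≤ 2 * ni ^ 2 * Ni⁻¹ * E + 2 * d ^ 3 * (ni ^ 2 * θ) ^ 2 * (Ni⁻¹ * S0))
    (hJ : Si ≤ Ni⁻¹ * S0) :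
    (Ni * a)⁻¹ * S0 ≤ Si1 + 2 * (ni * L) ^ 2 * (Ni * a)⁻¹ * E + d ^ 3 * ((ni * L) ^ 2 * θ) ^ 2 * ((Ni * a)⁻¹ * S0) := by
  have hNi' : 0 ≤ Ni⁻¹ := inv_nonneg.2 hNi.le
  have hR0 : 0 ≤ Ni⁻¹ * S0 := mul_nonneg hNi' hS0
  have hW0 : 0 ≤ ni ^ 2 * (Ni⁻¹ * E) := mul_nonneg (sq_nonneg _) (mul_nonneg hNi' hE)
  have hZ0 : 0 ≤ d ^ 3 * (ni ^ 2 * θ) ^ 2 * (Ni⁻¹ * S0) := mul_nonneg (mul_nonneg (pow_nonneg hd 3) (sq_nonneg _)) hR0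
  have hLL : 0 ≤ L * (L - 1) := by nlinarith
  -- (1) the bracket of the one-level inequality: Jensen on the defect term, then the bond-form bound
  have hτ : 0 ≤ d ^ 3 * (L - 1) ^ 2 * (ni ^ 2 * θ) ^ 2 :=
    mul_nonneg (mul_nonneg (pow_nonneg hd 3) (sq_nonneg _)) (sq_nonneg _)
  have hτSi : d ^ 3 * (L - 1) ^ 2 * (ni ^ 2 * θ) ^ 2 * Si ≤ d ^ 3 * (L - 1) ^ 2 * (ni ^ 2 * θ) ^ 2 * (Ni⁻¹ * S0) :=
    mul_le_mul_of_nonneg_left hJ hτ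
  have hbr : Ei + d * (d * (L - 1) * (ni ^ 2 * θ)) ^ 2 * Si
      ≤ 2 * ni ^ 2 * Ni⁻¹ * E + (2 + (L - 1) ^ 2) * (d ^ 3 * (ni ^ 2 * θ) ^ 2 * (Ni⁻¹ * S0)) := by
    have e : d * (d * (L - 1) * (ni ^ 2 * θ)) ^ 2 * Si = d ^ 3 * (L - 1) ^ 2 * (ni ^ 2 * θ) ^ 2 * Si := by ring
    rw [e]
    linarith
  -- (2) insert into the one-level inequality
  have hSi' : Si ≤ a * Si1 + L * (L - 1) * (2 * ni ^ 2 * Ni⁻¹ * E + (2 + (L - 1) ^ 2) * (d ^ 3 * (ni ^ 2 * θ) ^ 2 * (Ni⁻¹ * S0))) := by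
    have := mul_le_mul_of_nonneg_left hbr hLL
    linarith
  -- (3) insert into the level-i mass bound; the polynomial bounds 2L(L−1) + 2 ≤ 2L², L(L−1)(2 + (L−1)²) + 1 ≤ L⁴
  have hp1 : 0 ≤ (L - 1) * (ni ^ 2 * (Ni⁻¹ * E)) := mul_nonneg (sub_nonneg.2 hL) hW0
  have h3L : 0 ≤ 3 * L ^ 2 - 2 * L + 1 := by nlinarith [sq_nonneg (L - 1), sq_nonneg L]
  have hp2 : 0 ≤ (L - 1) * (3 * L ^ 2 - 2 * L + 1) * (d ^ 3 * (ni ^ 2 * θ) ^ 2 * (Ni⁻¹ * S0)) :=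
    mul_nonneg (mul_nonneg (sub_nonneg.2 hL) h3L) hZ0
  have hR'' : Ni⁻¹ * S0 ≤ a * Si1 + 2 * L ^ 2 * (ni ^ 2 * (Ni⁻¹ * E)) + L ^ 4 * (d ^ 3 * (ni ^ 2 * θ) ^ 2 * (Ni⁻¹ * S0)) := by
    linarith
  -- (4) divide by a
  have hfin := mul_le_mul_of_nonneg_left hR'' (inv_nonneg.2 ha.le)
  have e3 : a⁻¹ * (a * Si1) = Si1 := by field_simp
  rw [mul_inv]
  linarith

/-- **THE MULTISCALE MASS BOUND** (HOME/GAPS.md G-C1-05 item (ii), for every `u`): for every `U(1)` field `u` on the `η`-lattice torus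
`T^{(j)}` whose plaquette variables deviate from `1` by at most `θ`, every `k` with `j + k ≤ m + K` and every `φ : T^{(j)} → ℂ`, with
`n = L^k`, `N = L^{kd}`:
`N^{−1}Σ_x|φ(x)|² ≤ Σ_y|(Q_k(u)φ)(y)|² + 2(n²/N)Σ_b|u_bφ(b₊) − φ(b₋)|² + d³(n²θ)²·N^{−1}Σ_x|φ(x)|²` — no constant depends on `k`, `L`, the
volume or `u`.  Telescoping of the one-level covariant Poincaré inequality over the levels `i < k` (at level `i`: the field `u^{(i)} = lineIter u i`,
plaquettes `≤ L^{2i}θ`; bond form of `Q_iφ` by `bondForm_qCovK_le`; Jensen), `massBound_step_real`. [cite: BalabanImbrieJaffe1985, (7.3.2) p.326] -/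
theorem massBound {k : ℕ} (hk : j + k ≤ P.m + P.K) (U : GaugeField P j U1) {θ : ℝ}
    (hθ : ∀ (x : Balaban1983to89.Site P j) (μ ν : Fin P.d), ‖plaqC U x μ ν - 1‖ ≤ θ) (φ : HiggsField P j) :
    ((P.L : ℝ) ^ (k * P.d))⁻¹ * ∑ x : Balaban1983to89.Site P j, ‖φ x‖ ^ 2
      ≤ ∑ y : Balaban1983to89.Site P (j+k), ‖qCovK U k φ y‖ ^ 2
        + 2 * ((P.L : ℝ) ^ k) ^ 2 * ((P.L : ℝ) ^ (k * P.d))⁻¹ * ∑ b : PBond P j, ‖toC (U b) * φ b.tgt - φ b.src‖ ^ 2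
        + (P.d : ℝ) ^ 3 * (((P.L : ℝ) ^ k) ^ 2 * θ) ^ 2
          * (((P.L : ℝ) ^ (k * P.d))⁻¹ * ∑ x : Balaban1983to89.Site P j, ‖φ x‖ ^ 2) := by
  have hθ0 : 0 ≤ θ := (norm_nonneg _).trans (hθ default ⟨0, P.hd⟩ ⟨0, P.hd⟩)
  have hL1 : (1 : ℝ) ≤ P.L := by exact_mod_cast P.L_pos
  have hLpos : (0 : ℝ) < P.L := by linarith
  -- the statement at every level i ≤ k, by induction on i
  suffices H : ∀ i : ℕ, i ≤ k →
      ((P.L : ℝ) ^ (i * P.d))⁻¹ * ∑ x : Balaban1983to89.Site P j, ‖φ x‖ ^ 2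
        ≤ ∑ y : Balaban1983to89.Site P (j+i), ‖qCovK U i φ y‖ ^ 2
          + 2 * ((P.L : ℝ) ^ i) ^ 2 * ((P.L : ℝ) ^ (i * P.d))⁻¹ * ∑ b : PBond P j, ‖toC (U b) * φ b.tgt - φ b.src‖ ^ 2
          + (P.d : ℝ) ^ 3 * (((P.L : ℝ) ^ i) ^ 2 * θ) ^ 2
            * (((P.L : ℝ) ^ (i * P.d))⁻¹ * ∑ x : Balaban1983to89.Site P j, ‖φ x‖ ^ 2) from H k le_rfl
  intro i
  induction i with
  | zero =>
    intro _
    show ((P.L : ℝ) ^ (0 * P.d))⁻¹ * ∑ x : Balaban1983to89.Site P j, ‖φ x‖ ^ 2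
      ≤ ∑ y : Balaban1983to89.Site P j, ‖φ y‖ ^ 2
        + 2 * ((P.L : ℝ) ^ 0) ^ 2 * ((P.L : ℝ) ^ (0 * P.d))⁻¹ * ∑ b : PBond P j, ‖toC (U b) * φ b.tgt - φ b.src‖ ^ 2
        + (P.d : ℝ) ^ 3 * (((P.L : ℝ) ^ 0) ^ 2 * θ) ^ 2
          * (((P.L : ℝ) ^ (0 * P.d))⁻¹ * ∑ x : Balaban1983to89.Site P j, ‖φ x‖ ^ 2)
    simp only [zero_mul, pow_zero, inv_one, one_mul, one_pow, mul_one]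
    have h0 : 0 ≤ 2 * (∑ b : PBond P j, ‖toC (U b) * φ b.tgt - φ b.src‖ ^ 2)
        + (P.d : ℝ) ^ 3 * θ ^ 2 * ∑ x : Balaban1983to89.Site P j, ‖φ x‖ ^ 2 := by positivity
    linarith
  | succ i ih =>
    intro hi
    have hi' : j + i + 1 ≤ P.m + P.K := by omega
    have IH := ih (by omega)
    -- the four inputs at level i
    have hstar := covPoincare_oneLevel (i := j + i) hi' (lineIter U i)
      (fun x μ ν => norm_plaqC_lineIter_sub_one_le U hθ i (by omega) x μ ν) (qCovK U i φ)
    have hB := bondForm_qCovK_le (k := i) (by omega) U hθ φ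
    have hJ := sum_norm_qCovK_sq_le (k := i) (by omega) U φ
    -- exponent bookkeeping
    have eN : (P.L : ℝ) ^ ((i + 1) * P.d) = (P.L : ℝ) ^ (i * P.d) * (P.L : ℝ) ^ P.d := by
      rw [Nat.succ_mul, pow_add]
    have en : (P.L : ℝ) ^ (i + 1) = (P.L : ℝ) ^ i * P.L := pow_succ _ _
    have eθ : (((P.L : ℝ) ^ 2) ^ i * θ) = ((P.L : ℝ) ^ i) ^ 2 * θ := by rw [← pow_mul, ← pow_mul, mul_comm 2 i]
    have eS : ∑ y : Balaban1983to89.Site P (j + (i + 1)), ‖qCovK U (i + 1) φ y‖ ^ 2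
        = ∑ y : Balaban1983to89.Site P (j + i + 1), ‖qCov (lineIter U i) (qCovK U i φ) y‖ ^ 2 := rfl
    have eB : ∑ b : PBond P (j+i), ‖toC (lineIter U i b) * qCovK U i φ b.tgt - qCovK U i φ b.src‖ ^ 2
        = ∑ b : PBond P (j+i), ‖toC (lineIter U i b) * qCovK U i φ b.tgt - qCovK U i φ b.src‖ ^ 2 := rfl
    rw [eN, en, eS]
    rw [eθ] at hstar
    have hdiv : 2 * (((P.L : ℝ) ^ i) ^ 2 / (P.L : ℝ) ^ (i * P.d)) = 2 * ((P.L : ℝ) ^ i) ^ 2 * ((P.L : ℝ) ^ (i * P.d))⁻¹ := by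
      rw [div_eq_mul_inv, mul_assoc]
    rw [hdiv] at hB
    exact massBound_step_real (a := (P.L : ℝ) ^ P.d) (L := P.L) (Ni := (P.L : ℝ) ^ (i * P.d)) (ni := (P.L : ℝ) ^ i)
      (θ := θ) (d := P.d) hL1 (pow_pos hLpos _) (pow_pos hLpos _) (Nat.cast_nonneg _)
      (sum_nonneg fun _ _ => by positivity) (sum_nonneg fun _ _ => by positivity) IH hstar hB hJ

/-- **The absorbed form**: if `2d³(n²θ)² ≤ 1` (the field strength at the unit scale is small) then, for every `u`, `k`, `φ` as above,
`N^{−1}Σ_x|φ(x)|² ≤ 2Σ_y|(Q_k(u)φ)(y)|² + 4(n²/N)Σ_b|u_bφ(b₊) − φ(b₋)|²` — the `u`-UNIFORM block Poincaré (mass) bound for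
`‖D_uφ‖² + a‖Q_k(u)φ‖²` asked for in HOME/GAPS.md G-C1-05 item (ii). [cite: BalabanImbrieJaffe1985, (7.3.2) p.326] -/
theorem massBound_small {k : ℕ} (hk : j + k ≤ P.m + P.K) (U : GaugeField P j U1) {θ : ℝ}
    (hθ : ∀ (x : Balaban1983to89.Site P j) (μ ν : Fin P.d), ‖plaqC U x μ ν - 1‖ ≤ θ)
    (hsmall : 2 * (P.d : ℝ) ^ 3 * (((P.L : ℝ) ^ k) ^ 2 * θ) ^ 2 ≤ 1) (φ : HiggsField P j) :
    ((P.L : ℝ) ^ (k * P.d))⁻¹ * ∑ x : Balaban1983to89.Site P j, ‖φ x‖ ^ 2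
      ≤ 2 * ∑ y : Balaban1983to89.Site P (j+k), ‖qCovK U k φ y‖ ^ 2
        + 4 * ((P.L : ℝ) ^ k) ^ 2 * ((P.L : ℝ) ^ (k * P.d))⁻¹ * ∑ b : PBond P j, ‖toC (U b) * φ b.tgt - φ b.src‖ ^ 2 := by
  have h := massBound hk U hθ φ
  have hS : 0 ≤ ((P.L : ℝ) ^ (k * P.d))⁻¹ * ∑ x : Balaban1983to89.Site P j, ‖φ x‖ ^ 2 := by positivity
  nlinarith [mul_le_mul_of_nonneg_right hsmall hS]

end

end Literature.MathematicalPhysics.QuantumFieldTheory.BalabanImbrieJaffe1984to88.BIJ85CovariantPoincare
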